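import Mathlib
import HarnessLib.Audit.Tags

/-!
# Reading the instrument's INTEGER certificate in `ℚ[x]` (TODO-29 remainder, last links; bus R323, R328)

Honest framing: elementary commutative algebra, PROVED; no curve, no Galois-image determination, no modularity
claim, no new census, nothing numerical, no instrument touched; it says nothing about any census member.
Mathlib-only (checkable independently of the cell's olean lag).
Context.  `NormCertificate.lean` (p372945) proved: `F ∣ Norm_{ℚ[x][Y]/(S̃)}(G)` (Mathlib's `Algebra.norm`) ⇒ the
root form of the rung-23a pair-sum certificate, for RATIONAL data.  The instrument `res23.py` works with INTEGER
data: the integer sextic `f` (`fz`), a monic integer cubic `S̃` (`Sz`, roots `lc·sᵢ`) certified to have NO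
INTEGER ROOT (`S_has_rational_root`; for a monic integer cubic a rational root is an integer), and the integer
divisibility `f ∣ Norm_{ℤ[x][Y]/(S̃)}(G)`, `G = lc⁶·f(Y/lc − x)`.  This file types the three reading steps:
* `map_norm_adjoinRoot_mk` — the norm of `R[Y]/(T)` (`T` monic) commutes with ANY ring map `φ : R → R'`
  (power basis `AdjoinRoot.powerBasisAux'`, `Algebra.norm_eq_matrix_det`, entries `((G·Y^j) %ₘ T).coeff i`,
  `RingHom.map_det`, `Polynomial.map_modByMonic`); in particular with `ℤ[x] → ℚ[x]`;
* `map_norm_integerCertificate` — hence the integer norm, read in `ℚ[x]`, EQUALS the rational norm of the mapped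
  data, with the instrument's objects `Sz.map C`, `C (C lc)·(fz(Y − x)).integralNormalization` mapped to their
  rational counterparts (`integralNormalization_map`, `Polynomial.map_comp`); so `dvd_norm_map_of_map_dvd_map_norm_int`
  (the instrument's `pdivisible` tests divisibility of the integer norm by `f` IN `ℚ[x]` — referee g43 R-7 — and
  that is literally the rational norm divisibility) and `dvd_norm_map_of_dvd_norm_int` (from ℤ[x]-divisibility, formally
  stronger; equal here by Gauss's lemma, untyped);
* `irreducible_map_of_forall_not_isRoot` — a monic integer cubic with no integer root is irreducible over `ℚ`
  (`isInteger_of_is_root_of_monic` + `irreducible_iff_roots_eq_zero_of_degree_le_three`); `forall_not_isRoot_int_of_map`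
  / `irreducible_map_of_forall_not_isRoot_zmod` — no root modulo some `p` (a FINITE check, the float-free replacement
  of the instrument's float-seeded search; referee g43 R-8) suffices; and
  `irreducible_scaleRoots_of_ne_zero` — scaling roots by a non-zero scalar preserves irreducibility over a field
  (the pair-sum cubic is `S = S̃.scaleRoots lc⁻¹`).
The Sextic-level composite «integer certificate ⇒ `HasTwoBlocks f` ⇒ `|Gal| ∣ 48`» is filed separately once the
pending siblings are in the tree (bus R315/R318/R321).  After this file NOTHING of the OBJECT→THEOREM link of rung
23a is untyped except reading the instrument's loops as the definitions of `Algebra.norm` (determinant of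
multiplication in the basis `1, Y, Y²`) and of polynomial division in `ℚ[x]`, and — unless a witness prime is
supplied and (A3″) used — the soundness of its floating-point integer-root search.  Registered on the cell bus as
R323 (cell «pub-residmod», 2026-08-23; as for R320 the registration follows the feasibility probe and precedes the
proposal); (A4⁰), (A4′), (A3′), (A3″) registered R328 before proof (referee g43 findings R-7 / R-8).

Main results (all PROVED, axioms `propext`, `Classical.choice`, `Quot.sound` only):
* `map_norm_adjoinRoot_mk`, `map_norm_integerCertificate`, `dvd_norm_map_of_map_dvd_map_norm_int`,
  `dvd_norm_map_of_dvd_norm_int`;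
* `irreducible_scaleRoots_of_ne_zero`, `irreducible_map_of_forall_not_isRoot`, `forall_not_isRoot_int_of_map`,
  `irreducible_map_of_forall_not_isRoot_zmod`.
-/

open Polynomial

namespace Summit.Ventures.ResidMod.Conjectures

section IntegerCertificate

/-- **(A1) Base change of the norm of `R[Y]/(T)`, `T` monic, along any ring map.**  In the power basis
`1, Y, …, Y^(d-1)` the multiplication matrix of `G` has entries `((G·Y^j) %ₘ T).coeff i`, on which `φ` acts
entrywise. [elementary commutative algebra] -/
theorem map_norm_adjoinRoot_mk {R R' : Type*} [CommRing R] [CommRing R'] [Nontrivial R'] (φ : R →+* R')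
    {T : R[X]} (hT : T.Monic) (G : R[X]) :
    φ (Algebra.norm R (AdjoinRoot.mk T G)) = Algebra.norm R' (AdjoinRoot.mk (T.map φ) (G.map φ)) := by
  classical
  have hTφ : (T.map φ).Monic := hT.map φ
  set b := AdjoinRoot.powerBasisAux' hT with hb
  set bE := AdjoinRoot.powerBasisAux' hTφ with hbE
  have hdeg : T.natDegree = (T.map φ).natDegree := (hT.natDegree_map φ).symm
  set e : Fin T.natDegree ≃ Fin (T.map φ).natDegree := finCongr hdeg with he
  have hent : ∀ i j : Fin T.natDegree, φ (Algebra.leftMulMatrix b (AdjoinRoot.mk T G) i j) =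
      Algebra.leftMulMatrix bE (AdjoinRoot.mk (T.map φ) (G.map φ)) (e i) (e j) := by
    intro i j
    rw [Algebra.leftMulMatrix_eq_repr_mul, Algebra.leftMulMatrix_eq_repr_mul]
    have hbj : b j = AdjoinRoot.root T ^ (j : ℕ) := by
      rw [hb]; exact (AdjoinRoot.powerBasis' hT).basis_eq_pow j
    have hbEj : bE (e j) = AdjoinRoot.root (T.map φ) ^ (j : ℕ) := by
      have := (AdjoinRoot.powerBasis' hTφ).basis_eq_pow (e j)
      rw [he, finCongr_apply_coe] at this
      rw [hbE, he]; exact this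
    have e1 : AdjoinRoot.mk T G * AdjoinRoot.root T ^ (j : ℕ) = AdjoinRoot.mk T (G * X ^ (j : ℕ)) := by
      rw [map_mul, map_pow, AdjoinRoot.mk_X]
    have e2 : AdjoinRoot.mk (T.map φ) (G.map φ) * AdjoinRoot.root (T.map φ) ^ (j : ℕ)
        = AdjoinRoot.mk (T.map φ) ((G * X ^ (j : ℕ)).map φ) := by
      rw [Polynomial.map_mul, Polynomial.map_pow, map_X, map_mul, map_pow, AdjoinRoot.mk_X]
    rw [hbj, hbEj, e1, e2, hb, hbE, AdjoinRoot.powerBasisAux'_repr_apply_to_fun,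
      AdjoinRoot.powerBasisAux'_repr_apply_to_fun, AdjoinRoot.modByMonicHom_mk, AdjoinRoot.modByMonicHom_mk,
      ← Polynomial.map_modByMonic φ hT, coeff_map]
    simp [he]
  have hmat : φ.mapMatrix (Algebra.leftMulMatrix b (AdjoinRoot.mk T G))
      = (Algebra.leftMulMatrix bE (AdjoinRoot.mk (T.map φ) (G.map φ))).submatrix e e := by
    ext i j
    simp only [RingHom.mapMatrix_apply, Matrix.map_apply, Matrix.submatrix_apply]
    exact hent i j
  rw [Algebra.norm_eq_matrix_det b, RingHom.map_det, hmat, Matrix.det_submatrix_equiv_self,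
    ← Algebra.norm_eq_matrix_det bE]

/-- **(A2) Scaling the roots by a non-zero scalar preserves irreducibility over a field.** -/
theorem irreducible_scaleRoots_of_ne_zero {K : Type*} [Field K] {p : K[X]} (hp : Irreducible p) {c : K}
    (hc : c ≠ 0) : Irreducible (p.scaleRoots c) := by
  have hback : ∀ q : K[X], (q.scaleRoots c).scaleRoots c⁻¹ = q := fun q => by
    rw [← scaleRoots_mul, mul_inv_cancel₀ hc, scaleRoots_one]
  refine ⟨fun hu => hp.not_isUnit ?_, fun a b hab => ?_⟩
  · rw [Polynomial.isUnit_iff_degree_eq_zero, degree_scaleRoots] at hu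
    exact Polynomial.isUnit_iff_degree_eq_zero.mpr hu
  · have hp' : p = a.scaleRoots c⁻¹ * b.scaleRoots c⁻¹ := by
      rw [← hback p, hab, mul_scaleRoots_of_noZeroDivisors]
    rcases hp.isUnit_or_isUnit hp' with h | h
    · left
      rw [Polynomial.isUnit_iff_degree_eq_zero, degree_scaleRoots] at h
      exact Polynomial.isUnit_iff_degree_eq_zero.mpr h
    · right
      rw [Polynomial.isUnit_iff_degree_eq_zero, degree_scaleRoots] at h
      exact Polynomial.isUnit_iff_degree_eq_zero.mpr h

/-- **(A3) A monic integer cubic with no integer root is irreducible over `ℚ`** (rational root theorem: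
`isInteger_of_is_root_of_monic`; a cubic over a field with no root is irreducible). -/
theorem irreducible_map_of_forall_not_isRoot {Sz : ℤ[X]} (hSzm : Sz.Monic) (hSz3 : Sz.natDegree = 3)
    (hno : ∀ n : ℤ, ¬ Sz.IsRoot n) : Irreducible (Sz.map (Int.castRingHom ℚ)) := by
  have hdeg : (Sz.map (Int.castRingHom ℚ)).natDegree = 3 := by rw [hSzm.natDegree_map, hSz3]
  rw [irreducible_iff_roots_eq_zero_of_degree_le_three (by omega) (by omega),
    Multiset.eq_zero_iff_forall_notMem]
  intro q hq
  have hne : Sz.map (Int.castRingHom ℚ) ≠ 0 := (hSzm.map _).ne_zero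
  have hq' : aeval q Sz = 0 := by
    have := (mem_roots hne).mp hq
    rwa [IsRoot.def, ← algebraMap_int_eq, eval_map_algebraMap] at this
  obtain ⟨n, hn⟩ := isInteger_of_is_root_of_monic hSzm hq'
  apply hno n
  have h2 : aeval (algebraMap ℤ ℚ n) Sz = 0 := by rwa [hn]
  rw [aeval_algebraMap_apply_eq_algebraMap_eval] at h2
  exact (algebraMap ℤ ℚ).injective_int (by rwa [map_zero])

/-- **(A4⁰) The instrument's INTEGER norm, read in `ℚ[x]`, is the rational norm of the mapped data** (bus R328,
referee g43 R-7).  For `fz, Sz ∈ ℤ[X]` with `fz ≠ 0` and `Sz` monic,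
`(Norm_{ℤ[x][Y]/(S̃)}(C (C lc)·(fz(Y − x)).integralNormalization)).map ι`
`= Norm_{ℚ[x][Y]/(S̃_ℚ)}(C (C lc)·(F(Y − x)).integralNormalization)` with `ι : ℤ → ℚ`, `F = fz.map ι`,
`S̃_ℚ = (Sz.map ι).map C`: `map_norm_adjoinRoot_mk` along `Φ = mapRingHom ι` plus `integralNormalization_map` /
`Polynomial.map_comp` to identify the mapped objects. [elementary commutative algebra] -/
theorem map_norm_integerCertificate (fz Sz : ℤ[X]) (hfz : fz ≠ 0) (hSzm : Sz.Monic) :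
    (Algebra.norm ℤ[X] (AdjoinRoot.mk (Sz.map (C : ℤ →+* ℤ[X]))
      (C (C fz.leadingCoeff) * ((fz.map (C : ℤ →+* ℤ[X])).comp (X - C (X : ℤ[X]))).integralNormalization))).map
        (Int.castRingHom ℚ)
    = Algebra.norm ℚ[X] (AdjoinRoot.mk ((Sz.map (Int.castRingHom ℚ)).map (C : ℚ →+* ℚ[X]))
      (C (C (fz.map (Int.castRingHom ℚ)).leadingCoeff) *
        (((fz.map (Int.castRingHom ℚ)).map (C : ℚ →+* ℚ[X])).comp (X - C (X : ℚ[X]))).integralNormalization)) := by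
  set ι : ℤ →+* ℚ := Int.castRingHom ℚ with hι
  set Φ : ℤ[X] →+* ℚ[X] := mapRingHom ι with hΦ
  have hιinj : Function.Injective ι := ι.injective_int
  have hΦC : Φ.comp (C : ℤ →+* ℤ[X]) = (C : ℚ →+* ℚ[X]).comp ι := by
    ext a
    simp [hΦ]
  have hΦX : Φ X = X := by simp [hΦ]
  have hTm : (Sz.map (C : ℤ →+* ℤ[X])).Monic := hSzm.map _
  have hT : (Sz.map (C : ℤ →+* ℤ[X])).map Φ = (Sz.map ι).map (C : ℚ →+* ℚ[X]) := by
    rw [Polynomial.map_map, hΦC, ← Polynomial.map_map]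
  have hlc : (fz.map ι).leadingCoeff = ι fz.leadingCoeff := leadingCoeff_map_of_injective hιinj _
  set gz : ℤ[X][X] := (fz.map (C : ℤ →+* ℤ[X])).comp (X - C (X : ℤ[X])) with hgz
  have hsub : (X - C (X : ℤ[X])).natDegree = 1 := natDegree_X_sub_C _
  have hgzlc : gz.leadingCoeff = C fz.leadingCoeff := by
    rw [hgz, leadingCoeff_comp (by rw [hsub]; exact one_ne_zero), leadingCoeff_map_of_injective C_injective,
      leadingCoeff_X_sub_C, one_pow, mul_one]
  have hH : Φ gz.leadingCoeff ≠ 0 := by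
    rw [hgzlc]
    have : Φ (C fz.leadingCoeff) = C (ι fz.leadingCoeff) := by simp [hΦ]
    rw [this, Ne, Polynomial.C_eq_zero]
    exact (map_ne_zero_iff ι hιinj).mpr (leadingCoeff_ne_zero.mpr hfz)
  have hg : gz.map Φ = ((fz.map ι).map (C : ℚ →+* ℚ[X])).comp (X - C (X : ℚ[X])) := by
    rw [hgz, Polynomial.map_comp, Polynomial.map_map, hΦC, ← Polynomial.map_map, Polynomial.map_sub, map_X,
      Polynomial.map_C, hΦX]
  have hG : (C (C fz.leadingCoeff) * gz.integralNormalization).map Φ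
      = C (C (fz.map ι).leadingCoeff) *
        (((fz.map ι).map (C : ℚ →+* ℚ[X])).comp (X - C (X : ℚ[X]))).integralNormalization := by
    rw [Polynomial.map_mul, Polynomial.map_C, ← integralNormalization_map Φ gz hH, hg, hlc]
    congr 2
    simp [hΦ]
  have hnorm : Φ (Algebra.norm ℤ[X] (AdjoinRoot.mk (Sz.map (C : ℤ →+* ℤ[X]))
      (C (C fz.leadingCoeff) * gz.integralNormalization)))
      = Algebra.norm ℚ[X] (AdjoinRoot.mk ((Sz.map (C : ℤ →+* ℤ[X])).map Φ)
          ((C (C fz.leadingCoeff) * gz.integralNormalization).map Φ)) := map_norm_adjoinRoot_mk Φ hTm _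
  rw [hT, hG] at hnorm
  exact hnorm


/-- **(A4′) Reading `pdivisible`'s literal contract** (bus R328, referee g43 R-7): the instrument tests divisibility
of the INTEGER norm by `f` in `ℚ[x]` (integer pseudo-division, remainder `0`), i.e. `fz.map ι ∣ (Norm_ℤ …).map ι`;
by (A4⁰) this is the rational norm divisibility, hypothesis `hdvd` of `pairSum_of_dvd_norm` (`NormCertificate.lean`).
(ℤ[x]-divisibility, the hypothesis of (A4), is formally stronger; the two coincide here by Gauss's lemma since
`content(f)³` divides the norm — recorded, not typed.) [elementary commutative algebra] -/
theorem dvd_norm_map_of_map_dvd_map_norm_int {fz Sz : ℤ[X]} (hfz : fz ≠ 0) (hSzm : Sz.Monic)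
    (hdvd : fz.map (Int.castRingHom ℚ) ∣ (Algebra.norm ℤ[X] (AdjoinRoot.mk (Sz.map (C : ℤ →+* ℤ[X]))
      (C (C fz.leadingCoeff) * ((fz.map (C : ℤ →+* ℤ[X])).comp (X - C (X : ℤ[X]))).integralNormalization))).map
        (Int.castRingHom ℚ)) :
    fz.map (Int.castRingHom ℚ) ∣ Algebra.norm ℚ[X] (AdjoinRoot.mk
      ((Sz.map (Int.castRingHom ℚ)).map (C : ℚ →+* ℚ[X]))
      (C (C (fz.map (Int.castRingHom ℚ)).leadingCoeff) *
        (((fz.map (Int.castRingHom ℚ)).map (C : ℚ →+* ℚ[X])).comp (X - C (X : ℚ[X]))).integralNormalization)) :=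
  map_norm_integerCertificate fz Sz hfz hSzm ▸ hdvd

/-- **(A4) Reading the instrument's integer certificate in `ℚ[x]`.**  For `fz, Sz ∈ ℤ[X]` with `fz ≠ 0` and `Sz`
monic, the INTEGER divisibility `fz ∣ Norm_{ℤ[x][Y]/(S̃)}(C (C lc)·(fz(Y − x)).integralNormalization)` (the
instrument's objects built from the integer data, with ℤ[x]-divisibility) gives the RATIONAL divisibility that is
the hypothesis `hdvd` of `pairSum_of_dvd_norm` (`NormCertificate.lean`) for `F = fz.map ι`, `S̃_ℚ = Sz.map ι`:
`map_dvd` along `Φ = mapRingHom ι` and (A4′).  Statement unchanged from the accepted version (bus R323); proof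
re-derived through (A4⁰) (bus R328). [elementary commutative algebra] -/
theorem dvd_norm_map_of_dvd_norm_int {fz Sz : ℤ[X]} (hfz : fz ≠ 0) (hSzm : Sz.Monic)
    (hdvd : fz ∣ Algebra.norm ℤ[X] (AdjoinRoot.mk (Sz.map (C : ℤ →+* ℤ[X]))
      (C (C fz.leadingCoeff) * ((fz.map (C : ℤ →+* ℤ[X])).comp (X - C (X : ℤ[X]))).integralNormalization))) :
    fz.map (Int.castRingHom ℚ) ∣ Algebra.norm ℚ[X] (AdjoinRoot.mk
      ((Sz.map (Int.castRingHom ℚ)).map (C : ℚ →+* ℚ[X]))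
      (C (C (fz.map (Int.castRingHom ℚ)).leadingCoeff) *
        (((fz.map (Int.castRingHom ℚ)).map (C : ℚ →+* ℚ[X])).comp (X - C (X : ℚ[X]))).integralNormalization)) :=
  dvd_norm_map_of_map_dvd_map_norm_int hfz hSzm (map_dvd (mapRingHom (Int.castRingHom ℚ)) hdvd)

/-- **(A3′) No root under some ring map `ℤ → R` means no integer root** (bus R328, referee g43 R-8): an integer
root `n` of `Sz` maps to the root `φ n` of `Sz.map φ` (`Polynomial.IsRoot.map`).  With `R = ZMod p` this is the FINITE,
float-free replacement of the instrument's float-seeded integer-root search. [elementary commutative algebra] -/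
theorem forall_not_isRoot_int_of_map {R : Type*} [CommRing R] (φ : ℤ →+* R) {Sz : ℤ[X]}
    (hno : ∀ y : R, ¬ (Sz.map φ).IsRoot y) : ∀ n : ℤ, ¬ Sz.IsRoot n :=
  fun n hn => hno (φ n) (hn.map (f := φ))

/-- **(A3″) Witness-prime contract** (bus R328, referee g43 R-8): a monic integer cubic with no root modulo some
`p : ℕ` (for `p = 0`, `ZMod 0 = ℤ` and this is the integer-root test itself) is irreducible over `ℚ` —
(A3′) + (A3). [elementary commutative algebra] -/
theorem irreducible_map_of_forall_not_isRoot_zmod {Sz : ℤ[X]} (hSzm : Sz.Monic) (hSz3 : Sz.natDegree = 3)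
    (p : ℕ) (hno : ∀ y : ZMod p, ¬ (Sz.map (Int.castRingHom (ZMod p))).IsRoot y) :
    Irreducible (Sz.map (Int.castRingHom ℚ)) :=
  irreducible_map_of_forall_not_isRoot hSzm hSz3 (forall_not_isRoot_int_of_map (Int.castRingHom (ZMod p)) hno)

end IntegerCertificate

end Summit.Ventures.ResidMod.Conjectures
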